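import Literature.NumberTheory.EllipticCurves.Rank1Residual.Typed.X5DescentPairing
import HarnessLib

/-!
# Class X5 (`p = 2`): engine-H MODE A is an ITEM-FORM certificate at EVERY torsion rank —
# one `4`-covering without locally soluble `2`-coverings above one Ш-type `2`-covering
# (cell `b2b-bsdres`, unit `b2b-bsdres-sha-1`, gen 5; companion of `Typed/X5DescentPairing.lean`)

HONEST FRAMING (run/shared/lean/b2b/bsd-rank1-residual/, verbatim): prove what is provable now;
shrink each hard class to its core with data; no claim beyond stated classes. X5 stays
CONSTRUCTION-SHAPED; nothing here is a named fact or booked; the Cassels–Tate pairing enters only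
through `X5.bsdp_two_of_casselsTate_witness` (tree, bsd.S18 as a HYPOTHESIS); no `sorry`.

WHAT THIS FILE SETTLES. Engine H (explicit `8`-descent, Stamminger) values, for a `4`-covering
`C₄ → C_ξ → E` listed by the `4`-descent (an element `s ∈ Sel^(4)(E/ℚ)` above `ξ ∈ Sel^(2)(E/ℚ)`),
the fake `2`-Selmer set of `C₄`; EMPTY means `C₄` has no everywhere-locally-soluble `2`-covering
[Stamminger2005, Thm. 6.2.2], i.e. `s ∉ [2]_* Sel^(8)(E/ℚ)`. MODE A needs ONE element `η ∈ Ш(E/ℚ)`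
of exact order `4` that is not twice an element of `Ш`. The gen-4 bookkeeping asked, at torsion
rank `t ≥ 1`, for EVERY translate `s + κ₄(P)`, `P ∈ E(ℚ)`, to be certified (a whole `Ш[2]`-class of
`2`-coverings, `2^t` covers, every representative) because `η = π₄(s) ∈ 2Ш` only forces SOME
translate of `s` into `[2]_* Sel^(8)`. That requirement is unnecessary, by one line of the Kummer
diagram [SilvermanAEC2009, §X.4, Thm. X.4.2]: `κ₄ = [2]_* ∘ κ₈` on `E(ℚ)` (for `8R = P` the point
`Q = 2R` has `4Q = P`, and `σQ - Q = 2(σR - R)`), so every translate differs from `s` by an element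
of `[2]_* κ₈(E(ℚ)) ⊆ [2]_* Sel^(8)`; hence

  `π₄(s) ∈ 2·Ш  ⟺  s ∈ [2]_* Sel^(8)`                    (`two_divisible_iff_mem_range`),

for every `E/ℚ`, every rank, every torsion. The statement is proved here over the ABSTRACT
Kummer–Selmer diagram at levels `4 | 8` — additive groups `S₄, S₈` (the Selmer groups), `X` (`Ш`, or
any group receiving them), maps `π₄ : S₄ → X`, `π₈ : S₈ → X` (covering ↦ torsor class),
`d : S₈ → S₄` (`[2]_*`), with the three diagram facts as hypotheses: `π₄ ∘ d = 2·π₈`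
(functoriality), `π₈` onto `X[8]` (`Sel^(8) ↠ Ш[8]`), `ker π₄ ⊆ range d` (`ker π₄ = κ₄(E(ℚ)) =
[2]_* κ₈(E(ℚ))`) — exactly as `Typed/X5DescentPairing.lean` abstracts engine G's pairing as "any
bi-additive `B`". Consequence for the certificate (`X5.bsdp_two_of_casselsTate_item`): at EVERY
torsion rank, ONE engine-H item — a listed `4`-covering `s` above a Ш-type `ξ` (`2·π₄(s) ≠ 0`:
`ξ ∉ κ₂(E(ℚ))`; on the rank-`0` core "not torsion-type", certified by elimination once the
`2^t - 1` torsion-type covers are identified by rational points) whose fake `2`-Selmer set is EMPTY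
(`s ∉ range d`) — is the witness `hη` of `X5.bsdp_two_of_casselsTate_witness`; with `#Ш[2] = 4`,
`Ш[2] ⊆ 2Ш`, `#Ш[4] = 16` (engines A/B/F, PARI), `ord₂ #Ш_an = 4` and bsd.S18 + GZK this is
`BSD(E,2)`. On the unit's `75`-curve core this turns the four curves 9266a1, 12870o2, 17040p1,
17040p2 (engine G exact; engine H previously 'incomplete' only because a second cover of the
`Ш[2]`-class was unfinished) into two-engine curves — see the unit's `SHA-CENSUS.md` (gen 5).
Mode S (structure-free: EVERY `s` above EVERY Ш-type `ξ` outside `range d`) is unaffected and still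
needs both `[2]_*`-fibre classes above each cover (the pigeonhole count of METHOD-H §3 (ii′)).

References: Silverman *AEC* §X.4, Thm. X.4.2 [SilvermanAEC2009]; Stamminger 2005 §1.3 and
Thm. 6.2.2 [Stamminger2005]; Merriman–Siksek–Smart 1996 §4 [MerrimanSiksekSmart1996];
Cremona–Fisher–O'Neil–Simon–Stoll, *Explicit n-descent I*, §1 [CremonaFisherONeilSimonStoll2008] (torsor classes and
the action of `E(ℚ)/nE(ℚ)` on `n`-coverings); Miller 2011 Def. 1.1 [Miller2011LMS].
-/

noncomputable section

open scoped Classical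

open WeierstrassCurve Literature.NumberTheory.EllipticCurves
  Literature.NumberTheory.EllipticCurves.Rank1Residual

namespace Literature.NumberTheory.EllipticCurves.Rank1Residual.Typed

/-! ### The Kummer–Selmer diagram at levels `4 | 8`, abstractly -/

section Diagram

variable {S₄ S₈ X : Type*} [AddCommGroup S₄] [AddCommGroup S₈] [AddCommGroup X]
  (π₄ : S₄ →+ X) (π₈ : S₈ →+ X) (d : S₈ →+ S₄)

/-- **A `4`-covering divisible in `Sel^(8)` has `2`-divisible torsor class**: if `s = [2]_* z` then
`π₄(s) = 2·π₈(z)` (functoriality alone). [cite: SilvermanAEC2009, §X.4, Thm. X.4.2] -/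
theorem two_divisible_of_mem_range (hcomm : ∀ z : S₈, π₄ (d z) = 2 • π₈ z) {s : S₄}
    (hs : ∃ z : S₈, d z = s) : ∃ w : X, 2 • w = π₄ s := by
  obtain ⟨z, rfl⟩ := hs
  exact ⟨π₈ z, (hcomm z).symm⟩

/-- **ITEM FORM, the load-bearing direction**: over the Kummer–Selmer diagram at levels `4 | 8`
(`π₄ ∘ [2]_* = 2·π₈`; `Sel^(8) ↠ Ш[8]`; `ker π₄ = κ₄(E(ℚ)) = [2]_* κ₈(E(ℚ)) ⊆ [2]_* Sel^(8)`), a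
`4`-covering `s` with `4·π₄(s) = 0` that is NOT in `[2]_* Sel^(8)` (no everywhere-locally-soluble
`2`-covering — e.g. EMPTY fake `2`-Selmer set, Stamminger Thm. 6.2.2) has torsor class `π₄(s)` NOT
divisible by `2` in `Ш` — no condition on the translates `s + κ₄(P)`, at any rank and torsion.
Proof: `2w = π₄(s)` gives `8w = 0`, a lift `z ∈ Sel^(8)` of `w`, `π₄(s - [2]_* z) = 0`, so
`s - [2]_* z ∈ ker π₄ ⊆ range [2]_*`, so `s ∈ range [2]_*`.
[cite: SilvermanAEC2009, §X.4, Thm. X.4.2] [cite: Stamminger2005, §1.3 and Thm. 6.2.2] -/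
theorem not_two_divisible_of_not_mem_range (hcomm : ∀ z : S₈, π₄ (d z) = 2 • π₈ z)
    (hsurj : ∀ w : X, 8 • w = 0 → ∃ z : S₈, π₈ z = w)
    (hker : ∀ s : S₄, π₄ s = 0 → ∃ z : S₈, d z = s)
    {s : S₄} (h4 : 4 • π₄ s = 0) (hs : ¬ ∃ z : S₈, d z = s) :
    ¬ ∃ w : X, 2 • w = π₄ s := by
  rintro ⟨w, hw⟩
  have h8 : 8 • w = 0 := by
    have h : (8 : ℕ) • w = 4 • (2 • w) := by rw [smul_smul]; norm_num
    rw [h, hw, h4]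
  obtain ⟨z, hz⟩ := hsurj w h8
  have hz' : π₄ (s - d z) = 0 := by rw [map_sub, hcomm, hz, hw, sub_self]
  obtain ⟨z', hz''⟩ := hker _ hz'
  exact hs ⟨z' + z, by rw [map_add, hz'', sub_add_cancel]⟩

/-- **`π₄(s) ∈ 2Ш ⟺ s ∈ [2]_* Sel^(8)`** over the Kummer–Selmer diagram at levels `4 | 8`: being
twice a torsor class is a property of the `4`-covering `s` itself, not of its `κ₄(E(ℚ))`-orbit.
[cite: SilvermanAEC2009, §X.4, Thm. X.4.2] -/
theorem two_divisible_iff_mem_range (hcomm : ∀ z : S₈, π₄ (d z) = 2 • π₈ z)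
    (hsurj : ∀ w : X, 8 • w = 0 → ∃ z : S₈, π₈ z = w)
    (hker : ∀ s : S₄, π₄ s = 0 → ∃ z : S₈, d z = s)
    {s : S₄} (h4 : 4 • π₄ s = 0) :
    (∃ w : X, 2 • w = π₄ s) ↔ ∃ z : S₈, d z = s := by
  constructor
  · intro h
    by_contra hs
    exact not_two_divisible_of_not_mem_range π₄ π₈ d hcomm hsurj hker h4 hs h
  · exact two_divisible_of_mem_range π₄ π₈ d hcomm

/-- **The mode-A witness from one item**: a `4`-covering `s` above a Ш-type `2`-covering
(`2·π₄(s) ≠ 0`, i.e. `[2]_* s ∉ κ₂(E(ℚ))`) with `4·π₄(s) = 0` and no locally soluble `2`-covering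
yields `η₀ = π₄(s)`: `4η₀ = 0`, `2η₀ ≠ 0`, `η₀ ∉ 2Ш` — the hypothesis `hη` of
`X5.bsdp_two_of_casselsTate_witness`. [cite: Stamminger2005, §1.3 and Thm. 6.2.2]
[cite: SilvermanAEC2009, §X.4, Thm. X.4.2] -/
theorem exists_witness_of_item (hcomm : ∀ z : S₈, π₄ (d z) = 2 • π₈ z)
    (hsurj : ∀ w : X, 8 • w = 0 → ∃ z : S₈, π₈ z = w)
    (hker : ∀ s : S₄, π₄ s = 0 → ∃ z : S₈, d z = s)
    {s : S₄} (h4 : 4 • π₄ s = 0) (hξ : 2 • π₄ s ≠ 0) (hs : ¬ ∃ z : S₈, d z = s) :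
    ∃ η₀ : X, 4 • η₀ = 0 ∧ 2 • η₀ ≠ 0 ∧ ¬ ∃ w : X, 2 • w = η₀ :=
  ⟨π₄ s, h4, hξ, not_two_divisible_of_not_mem_range π₄ π₈ d hcomm hsurj hker h4 hs⟩

/-- **Ш-type, abstractly**: with the level-`2` row of the diagram (`ρ = [2]_* : Sel^(4) → Sel^(2)`,
`π₂ : Sel^(2) → Ш`, `π₂ ∘ ρ = 2·π₄`), "`ξ = ρ(s)` is Ш-type" (`π₂ ξ ≠ 0`, i.e. `ξ ∉ ker π₂ =
κ₂(E(ℚ))`) is exactly `2·π₄(s) ≠ 0`. [cite: SilvermanAEC2009, §X.4, Thm. X.4.2] -/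
theorem two_smul_ne_zero_of_shaType {S₂ : Type*} [AddCommGroup S₂] (π₂ : S₂ →+ X) (ρ : S₄ →+ S₂)
    (hcomm₂ : ∀ s : S₄, π₂ (ρ s) = 2 • π₄ s) {s : S₄} (hξ : π₂ (ρ s) ≠ 0) : 2 • π₄ s ≠ 0 := by
  rwa [← hcomm₂]

end Diagram

/-! ### Over `ℚ`: `BSD(E,2)` from ONE engine-H item (mode A, any torsion rank) -/

section OverQ

variable (W : WeierstrassCurve ℚ) [W.IsElliptic] [W.IsGloballyMinimal]

/-- **X5 mode A, ITEM FORM at every torsion rank ⇒ `BSD(E,2)`** (granted GZK `hGZK` and Cassels'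
pairing bsd.S18 `hCT`, both HYPOTHESES): analytic rank `≤ 1`; `#Ш[2] = 4` and `Ш[2] ⊆ 2Ш`
(two-engine `2`- and `4`-descent data); the Kummer–Selmer diagram of `E` at levels `4 | 8` mapping to
`Ш(E/ℚ)` (`hcomm`, `hsurj`, `hker` — see `not_two_divisible_of_not_mem_range`); ONE `4`-covering
`s` above a Ш-type `2`-covering (`hξ`) with no everywhere-locally-soluble `2`-covering (`hs`: EMPTY
fake `2`-Selmer set, Stamminger Thm. 6.2.2); `#Ш[4] = 16`; `#Ш_an = q`, `ord₂ q = 4`. Then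
`BSD(E,2)` — via `exists_witness_of_item` and the tree's `X5.bsdp_two_of_casselsTate_witness`
(`Ш[2^∞]`'s order-`4` elements are all `2`-divisible or none is). No whole-`Ш[2]`-class condition.
Per curve; X5 stays a class. [cite: Stamminger2005, §1.3 and Thm. 6.2.2]
[cite: SilvermanAEC2009, §X.4, Thm. X.4.2 and Thm. X.4.14] [cite: Miller2011LMS, §1 and Def. 1.1] -/
theorem X5.bsdp_two_of_casselsTate_item (hGZK : rank_eq_analyticRank_of_analyticRank_le_one)
    (hCT : WeierstrassCurve.exists_casselsTate_pairing (K := ℚ)) (hr : W.analyticRank ≤ 1)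
    (h2 : Nat.card (AddSubgroup.torsionBy W.sha 2) = 4)
    (hdiv : ∀ z : W.sha, 2 • z = 0 → ∃ w : W.sha, 2 • w = z)
    {S₄ S₈ : Type*} [AddCommGroup S₄] [AddCommGroup S₈]
    (π₄ : S₄ →+ W.sha) (π₈ : S₈ →+ W.sha) (d : S₈ →+ S₄)
    (hcomm : ∀ z : S₈, π₄ (d z) = 2 • π₈ z)
    (hsurj : ∀ w : W.sha, 8 • w = 0 → ∃ z : S₈, π₈ z = w)
    (hker : ∀ s : S₄, π₄ s = 0 → ∃ z : S₈, d z = s)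
    {s : S₄} (h4 : 4 • π₄ s = 0) (hξ : 2 • π₄ s ≠ 0) (hs : ¬ ∃ z : S₈, d z = s)
    (hcard : Nat.card (AddSubgroup.torsionBy W.sha 4) = 16)
    {q : ℚ} (hq : shaAn W = (q : ℂ)) (hv : padicValRat 2 q = 4) : BSDp W 2 :=
  X5.bsdp_two_of_casselsTate_witness W hGZK hCT hr h2 hdiv
    (exists_witness_of_item π₄ π₈ d hcomm hsurj hker h4 hξ hs) hcard hq hv

end OverQ

end Literature.NumberTheory.EllipticCurves.Rank1Residual.Typed

end
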